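import Summits.Ventures.Crystal3D.Theorems.StickyWulffConstantPolycrystalWulffBoundQuantile
import Summits.Ventures.Crystal3D.Theorems.StickyWulffConstantPolycrystalWulffBoundPerSelf

/-!
# `PolycrystalWulffBound`, line `PolyDensity`: EXACT cap heights of the crux's Wulff body
# (data for the sorted piecewise Brunn–Minkowski rungs; crux `stmt-Ventures-19482`)

Route `StickyWulffConstant` of the venture `Summits/Ventures/Crystal3D`, second prover lane (poly-p2,
gen 12).  For a frame `A`, a unit vector `m` and a fraction `u ∈ [0, 1]` there is a height `s`,
`|s| ≤ √5 + 1`, with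

  `|W(A) ∩ {s < ⟪y, m⟫}| = 32·u`   EXACTLY

(`exists_capHeight_eq`) — read off the quantile function of the compact body
(`exists_quantile_of_isCompact`, gen 8: the two one-sided volume bounds at `σ = 1 − u` pinch).  The
sorted piecewise Brunn–Minkowski rungs (`twinCaps_chimera_lower`, `twinColonies_chimera_lower`) cut
their proportional targets out of the bodies at such heights.
WHAT THIS IS NOT: monotonicity of `s` in `u` (not needed: the rungs take `r` below the lamella gaps);
the crux is not claimed.
-/

noncomputable section

open scoped BigOperators InnerProductSpace ENNReal
open MeasureTheory Set

namespace Summit.Ventures.Crystal3D.Theorems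

open Literature.MathematicalPhysics.StatisticalMechanics (fccStacking)

/-- **Exact cap heights.**  For every frame `A`, unit `m` and `u ∈ [0,1]` there is `s` with
`|s| ≤ √5 + 1` and `|W(A) ∩ {s < ⟪y, m⟫}| = 32 u`. -/
theorem exists_capHeight_eq (A : EuclideanSpace ℝ (Fin 3) ≃ₗᵢ[ℝ] EuclideanSpace ℝ (Fin 3))
    (m : EuclideanSpace ℝ (Fin 3)) (hm : ‖m‖ = 1) {u : ℝ} (hu0 : 0 ≤ u) (hu1 : u ≤ 1) :
    ∃ s : ℝ, |s| ≤ Real.sqrt 5 + 1 ∧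
      volume ({y : EuclideanSpace ℝ (Fin 3) | ∀ ν : EuclideanSpace ℝ (Fin 3), ⟪y, ν⟫_ℝ ≤ Real.sqrt 2 / 4 *
          ∑ᶠ w ∈ {w | w ∈ fccStacking 1 (Real.sqrt (2 / 3)) ∧ ‖w‖ = 1}, |⟪w, A.symm ν⟫_ℝ|} ∩
        {y | s < ⟪y, m⟫_ℝ}) = ENNReal.ofReal (32 * u) := by
  set W : Set (EuclideanSpace ℝ (Fin 3)) := {y | ∀ ν : EuclideanSpace ℝ (Fin 3), ⟪y, ν⟫_ℝ ≤
    Real.sqrt 2 / 4 * ∑ᶠ w ∈ {w | w ∈ fccStacking 1 (Real.sqrt (2 / 3)) ∧ ‖w‖ = 1}, |⟪w, A.symm ν⟫_ℝ|}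
    with hW
  have hWc : IsCompact W := isCompact_cruxWulffBody A
  have hWm : MeasurableSet W := hWc.isClosed.measurableSet
  have hWvol : volume W = ENNReal.ofReal 32 := volume_cruxWulffBody A
  obtain ⟨q, hqR, hq⟩ := exists_quantile_of_isCompact m hm W hWc (Real.sqrt_nonneg 5)
    (cruxWulffBody_subset_closedBall A) (by norm_num : (0:ℝ) ≤ 32) hWvol
  refine ⟨q (1 - u), hqR _, le_antisymm ?_ ?_⟩
  · -- upper bound: the complementary lower cap has volume ≥ 32(1 − u)
    have h := hq 0 (1 - u) le_rfl (by linarith) (by linarith)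
    rw [show (1 - u - 0) * 32 = 32 * (1 - u) by ring] at h
    have hlow : ENNReal.ofReal (32 * (1 - u)) ≤ volume (W ∩ {y | ⟪y, m⟫_ℝ < q (1 - u)}) :=
      h.trans (measure_mono fun y hy => ⟨hy.1, hy.2.2⟩)
    have hgt_m : MeasurableSet {y : EuclideanSpace ℝ (Fin 3) | q (1 - u) < ⟪y, m⟫_ℝ} :=
      (isOpen_lt continuous_const (continuous_id.inner continuous_const)).measurableSet
    have hdisj : Disjoint (W ∩ {y | ⟪y, m⟫_ℝ < q (1 - u)}) (W ∩ {y | q (1 - u) < ⟪y, m⟫_ℝ}) := by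
      rw [Set.disjoint_left]
      rintro y ⟨-, hy1⟩ ⟨-, hy2⟩
      rw [mem_setOf_eq] at hy1 hy2
      exact lt_irrefl _ (lt_trans hy1 hy2)
    have hle : volume (W ∩ {y | ⟪y, m⟫_ℝ < q (1 - u)}) + volume (W ∩ {y | q (1 - u) < ⟪y, m⟫_ℝ}) ≤
        ENNReal.ofReal 32 := by
      rw [← measure_union hdisj (hWm.inter hgt_m), ← hWvol]
      exact measure_mono (union_subset inter_subset_left inter_subset_left)
    have hfin1 : volume (W ∩ {y | ⟪y, m⟫_ℝ < q (1 - u)}) ≠ ⊤ :=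
      (lt_of_le_of_lt (measure_mono inter_subset_left) hWc.measure_lt_top).ne
    have hfin2 : volume (W ∩ {y | q (1 - u) < ⟪y, m⟫_ℝ}) ≠ ⊤ :=
      (lt_of_le_of_lt (measure_mono inter_subset_left) hWc.measure_lt_top).ne
    rw [← ENNReal.ofReal_toReal hfin2]
    apply ENNReal.ofReal_le_ofReal
    have h1 := ENNReal.toReal_mono ENNReal.ofReal_ne_top hle
    rw [ENNReal.toReal_add hfin1 hfin2, ENNReal.toReal_ofReal (by norm_num : (0:ℝ) ≤ 32)] at h1
    have h2 := ENNReal.toReal_mono hfin1 hlow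
    rw [ENNReal.toReal_ofReal (by nlinarith)] at h2
    linarith
  · -- lower bound: the upper cap has volume ≥ 32 u
    have h := hq (1 - u) 1 (by linarith) (by linarith) le_rfl
    rw [show (1 - (1 - u)) * 32 = 32 * u by ring] at h
    exact h.trans (measure_mono fun y hy => ⟨hy.1, hy.2.1⟩)

end Summit.Ventures.Crystal3D.Theorems

end
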